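import Literature.Topology.FourManifolds.LefschetzHandlebody
import Literature.Topology.FourManifolds.PresentationHandlebodyFive
import Literature.Topology.FourManifolds.CorkDecompositionSplitting
import HarnessLib

/-!
# Transport of Lefschetz handlebodies and of (fibred) Lefschetz models along diffeomorphisms

Brick for the stub `stub_modelsOnFibred_of_reach` (NF4) of line `modp-braid-orbits` of the crux
`ConvexBisection.AcyclicBisectionExists` (item stmt-SmoothPoincare4-10508).  NF4 is the named fact
`Literature.Topology.FourManifolds.LefschetzBase.modelsOnFibred_of_reach` (fibred Lefschetz models
persist along signed Hurwitz moves and stabilisation pairs), reduced in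
`ConvexBisectionAcyclicBisectionExistsStubModelsOnFibredOfReach.lean` to the one-step statements
(HS) and (ST-front).  Every geometric realisation of (HS)/(ST) produces the new handlebody piece or
the new closed manifold only UP TO DIFFEOMORPHISM (Kosinski 1993, VI §6: `M ∪ H^λ` is well defined up
to diffeomorphism; Hirsch 1976, §8.2: so is `M ∪_φ N`), after which the three predicates of
`LefschetzHandlebody.lean` have to be moved along that diffeomorphism.  This file provides the
transport API, all proved by composing the witnessing smooth embeddings with the diffeomorphism:

* `IsLefschetzHandlebody.of_diffeomorph` / `helper_isLefschetzHandlebody_of_diffeomorph` (T1) —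
  `X(F; l) ≅ X'` makes `X'` a Lefschetz handlebody of the same word (same link `h`; the
  multi-attachment is transported by `HandleAttachingMap.IsMultiAttachment.of_diffeomorph`);
* `ModelsOn.of_diffeomorph` / `helper_modelsOn_of_diffeomorph`,
  `ModelsOnFibred.of_diffeomorph` / `helper_modelsOnFibred_of_diffeomorph` (T2) — the glued-manifold
  slot: `M ≅ M'` and `M = X ∪_Ψ Base g` give `M' = X ∪_Ψ Base g` with the same data
  (`IsBoundaryGluing.diffeomorph_comp`); the page condition only concerns `(X, D, bX, Ψ)` and is
  untouched;
* `modelsOnFibred_of_transfer` / `helper_modelsOnFibred_of_transfer` (T3) — the handlebody slot: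
  if `M = X ∪_Ψ Base g` and `G : X ≅ X'` where `X'` carries multi-attachment data `D'` of a
  Lefschetz link of word `l'`, and `Ψ` is page-preserving at the seam points `y` with
  `G (bX.incl y) = D'.jA a`, then `ModelsOnFibred M g l'`: the gluing is re-indexed along `G⁻¹`
  (`IsBoundaryGluing.transfer`, new gluing map `Ψ ∘ ∂G⁻¹ = (∂G⁻¹).trans Ψ` for ANY boundary datum
  `bX'` of `X'`, `BoundaryData.restrictDiffeomorph`), and the page condition is read through
  `bX.incl (∂G⁻¹ y') = G⁻¹ (bX'.incl y')` (`isBoundaryGluing_restrictDiffeomorph_trans`, stated for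
  general models).  The case `X' = X`, `G = refl` (`modelsOnFibred_of_data`) is the plain
  introduction rule with a new link on the same piece.  (For the SAME link nothing is to be
  transported: the data over `X` already witness `ModelsOnFibred M g l`.)

References: A. A. Kosinski, *Differential Manifolds* (1993), VI §1, §6 [Kosinski1993];
M. W. Hirsch, *Differential Topology* (1976), Ch. 8 §2 [HirschDT1976]; J. B. Etnyre, T. Fuller,
IMRN 2006, proof of Thm. 1 (p. 8) [EtnyreFuller2006].
-/

noncomputable section

set_option linter.dupNamespace false

open scoped Manifold ContDiff Topology
open Set Function

namespace Summit.SmoothPoincare4.SmoothPoincare4.Theorems.AcyclicBisectionExists.ModpBraidOrbits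

open Literature.Topology.FourManifolds Literature.Topology.FourManifolds.LefschetzBase
open Literature.Topology.FourManifolds.HandleAttachingMap

universe u v

/-! ### T1: the handlebody along a diffeomorphism -/

/-- **A manifold diffeomorphic to a Lefschetz handlebody of word `l` is a Lefschetz handlebody of
word `l`** (same Lefschetz link; the simultaneous attachment of the 2-handles is transported along
the diffeomorphism, Kosinski 1993, VI §6: `M ∪ H ∪ ⋯ ∪ H` is well defined up to diffeomorphism).
[cite: Kosinski1993, VI §6] -/
theorem IsLefschetzHandlebody.of_diffeomorph {g : ℕ} {l : List ((Fin g ⊕ Fin g → ℤ) × Bool)}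
    {X : Type u} [TopologicalSpace X] [ChartedSpace (EuclideanHalfSpace 4) X]
    [IsManifold (𝓡∂ 4) ∞ X] {X' : Type v} [TopologicalSpace X']
    [ChartedSpace (EuclideanHalfSpace 4) X'] [IsManifold (𝓡∂ 4) ∞ X']
    (hX : IsLefschetzHandlebody g l X) (G : X ≃ₘ⟮𝓡∂ 4, 𝓡∂ 4⟯ X') :
    IsLefschetzHandlebody g l X' := by
  obtain ⟨h, hlink, hmulti⟩ := hX
  exact ⟨h, hlink, hmulti.of_diffeomorph G⟩

/-- **T1, registered form: transport of `IsLefschetzHandlebody` along a diffeomorphism of the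
handlebody** (Kosinski 1993, VI §6). [cite: Kosinski1993, VI §6] -/
theorem helper_isLefschetzHandlebody_of_diffeomorph :
    ∀ (g : ℕ) (l : List ((Fin g ⊕ Fin g → ℤ) × Bool)) (X X' : Type) [TopologicalSpace X]
      [ChartedSpace (EuclideanHalfSpace 4) X] [IsManifold (𝓡∂ 4) ∞ X] [TopologicalSpace X']
      [ChartedSpace (EuclideanHalfSpace 4) X'] [IsManifold (𝓡∂ 4) ∞ X'],
      IsLefschetzHandlebody g l X → (X ≃ₘ⟮𝓡∂ 4, 𝓡∂ 4⟯ X') → IsLefschetzHandlebody g l X' :=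
  fun _ _ _ _ _ _ _ _ _ _ hX G => IsLefschetzHandlebody.of_diffeomorph hX G

/-! ### T2: the glued closed manifold along a diffeomorphism -/

/-- **A manifold diffeomorphic to a one-sided Lefschetz model is a one-sided Lefschetz model of the
same word** (same handlebody, boundary datum and gluing map; the gluing `M = X ∪_Ψ Base g` is
transported along `M ≅ M'`, Hirsch 1976, §8.2). [cite: HirschDT1976, Ch. 8 §2] -/
theorem ModelsOn.of_diffeomorph {M : Type} [TopologicalSpace M]
    [ChartedSpace (EuclideanSpace ℝ (Fin 4)) M] [IsManifold (𝓡 4) ∞ M] {M' : Type}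
    [TopologicalSpace M'] [ChartedSpace (EuclideanSpace ℝ (Fin 4)) M'] [IsManifold (𝓡 4) ∞ M']
    {g : ℕ} {l : List ((Fin g ⊕ Fin g → ℤ) × Bool)} (hM : ModelsOn M g l)
    (e : M ≃ₘ⟮𝓡 4, 𝓡 4⟯ M') : ModelsOn M' g l := by
  obtain ⟨X, _, _, _, _, _, _, bX, Ψ, hX, hglue⟩ := hM
  exact ⟨X, inferInstance, inferInstance, inferInstance, inferInstance, inferInstance, inferInstance,
    bX, Ψ, hX, hglue.diffeomorph_comp e⟩

/-- **T2 (weak model), registered form: transport of `ModelsOn` along a diffeomorphism of the closed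
manifold** (Hirsch 1976, §8.2). [cite: HirschDT1976, Ch. 8 §2] -/
theorem helper_modelsOn_of_diffeomorph :
    ∀ (M M' : Type) [TopologicalSpace M] [ChartedSpace (EuclideanSpace ℝ (Fin 4)) M]
      [IsManifold (𝓡 4) ∞ M] [TopologicalSpace M'] [ChartedSpace (EuclideanSpace ℝ (Fin 4)) M']
      [IsManifold (𝓡 4) ∞ M'] (g : ℕ) (l : List ((Fin g ⊕ Fin g → ℤ) × Bool)),
      ModelsOn M g l → (M ≃ₘ⟮𝓡 4, 𝓡 4⟯ M') → ModelsOn M' g l :=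
  fun _ _ _ _ _ _ _ _ _ _ hM e => ModelsOn.of_diffeomorph hM e

/-- **A manifold diffeomorphic to a fibred Lefschetz model is a fibred Lefschetz model of the same
word** (same handlebody, multi-attachment data, boundary datum and page-preserving gluing map; only
the gluing `M = X ∪_Ψ Base g` is transported along `M ≅ M'`, Hirsch 1976, §8.2; the page condition
does not mention `M`). [cite: HirschDT1976, Ch. 8 §2] -/
theorem ModelsOnFibred.of_diffeomorph {M : Type} [TopologicalSpace M]
    [ChartedSpace (EuclideanSpace ℝ (Fin 4)) M] [IsManifold (𝓡 4) ∞ M] {M' : Type}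
    [TopologicalSpace M'] [ChartedSpace (EuclideanSpace ℝ (Fin 4)) M'] [IsManifold (𝓡 4) ∞ M']
    {g : ℕ} {l : List ((Fin g ⊕ Fin g → ℤ) × Bool)} (hM : ModelsOnFibred M g l)
    (e : M ≃ₘ⟮𝓡 4, 𝓡 4⟯ M') : ModelsOnFibred M' g l := by
  obtain ⟨X, _, _, _, _, _, _, h, D, bX, Ψ, hlink, hglue, hpage⟩ := hM
  exact ⟨X, inferInstance, inferInstance, inferInstance, inferInstance, inferInstance, inferInstance,
    h, D, bX, Ψ, hlink, hglue.diffeomorph_comp e, hpage⟩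

/-- **T2 (fibred model), registered form: transport of `ModelsOnFibred` along a diffeomorphism of
the closed manifold** (Hirsch 1976, §8.2). [cite: HirschDT1976, Ch. 8 §2] -/
theorem helper_modelsOnFibred_of_diffeomorph :
    ∀ (M M' : Type) [TopologicalSpace M] [ChartedSpace (EuclideanSpace ℝ (Fin 4)) M]
      [IsManifold (𝓡 4) ∞ M] [TopologicalSpace M'] [ChartedSpace (EuclideanSpace ℝ (Fin 4)) M']
      [IsManifold (𝓡 4) ∞ M'] (g : ℕ) (l : List ((Fin g ⊕ Fin g → ℤ) × Bool)),
      ModelsOnFibred M g l → (M ≃ₘ⟮𝓡 4, 𝓡 4⟯ M') → ModelsOnFibred M' g l :=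
  fun _ _ _ _ _ _ _ _ _ _ hM e => ModelsOnFibred.of_diffeomorph hM e

/-! ### T3: the handlebody piece of a fibred model along a diffeomorphism -/

section GluingTransfer

variable {E H E₀ H₀ E₀' H₀' EW HW E₁ H₁ EP HP : Type*}
  [NormedAddCommGroup E] [NormedSpace ℝ E] [TopologicalSpace H] {I : ModelWithCorners ℝ E H}
  [NormedAddCommGroup E₀] [NormedSpace ℝ E₀] [TopologicalSpace H₀] {I₀ : ModelWithCorners ℝ E₀ H₀}
  [NormedAddCommGroup E₀'] [NormedSpace ℝ E₀'] [TopologicalSpace H₀']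
  {I₀' : ModelWithCorners ℝ E₀' H₀'}
  [NormedAddCommGroup EW] [NormedSpace ℝ EW] [TopologicalSpace HW] {IW : ModelWithCorners ℝ EW HW}
  [NormedAddCommGroup E₁] [NormedSpace ℝ E₁] [TopologicalSpace H₁] {I₁ : ModelWithCorners ℝ E₁ H₁}
  [NormedAddCommGroup EP] [NormedSpace ℝ EP] [TopologicalSpace HP] {IP : ModelWithCorners ℝ EP HP}
  {X X' W : Type u} [TopologicalSpace X] [ChartedSpace H X] [IsManifold I ∞ X]
  [TopologicalSpace X'] [ChartedSpace H X'] [IsManifold I ∞ X'] [TopologicalSpace W]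
  [ChartedSpace HW W] {P : Type v} [TopologicalSpace P] [ChartedSpace HP P]
  {bX : BoundaryData I X I₀} {bX' : BoundaryData I X' I₀'} {bW : BoundaryData IW W I₁}

/-- **A gluing re-indexed along a diffeomorphism of the first piece, with a diffeomorphism as the
new gluing map**: if `P = X ∪_Ψ W` and `G : X ≅ X'`, then `P = X' ∪_{(∂G⁻¹).trans Ψ} W` for any
boundary datum `bX'` of `X'` (`IsBoundaryGluing.transfer` along `G⁻¹`, whose gluing map
`Ψ ∘ ∂G⁻¹` is the coercion of the composite diffeomorphism).  Hirsch 1976, §8.2: `M ∪_φ N` depends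
on the pieces only up to diffeomorphism compatible with `φ`. [cite: HirschDT1976, Ch. 8 §2] -/
theorem isBoundaryGluing_restrictDiffeomorph_trans (Ψ : bX.carrier ≃ₘ⟮I₀, I₁⟯ bW.carrier)
    (hglue : IsBoundaryGluing bX bW Ψ IP P) (G : X ≃ₘ⟮I, I⟯ X') :
    IsBoundaryGluing bX' bW ((bX'.restrictDiffeomorph bX G.symm).trans Ψ) IP P := by
  have h1 := IsBoundaryGluing.transfer (b₁ := bX') G.symm hglue
  rwa [← Diffeomorph.coe_trans] at h1

end GluingTransfer

section Transfer

variable {M : Type} [TopologicalSpace M] [ChartedSpace (EuclideanSpace ℝ (Fin 4)) M] {g : ℕ}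
  {l : List ((Fin g ⊕ Fin g → ℤ) × Bool)}
  {X : Type} [TopologicalSpace X] [ChartedSpace (EuclideanHalfSpace 4) X] [IsManifold (𝓡∂ 4) ∞ X]
  {X' : Type} [TopologicalSpace X'] [T2Space X'] [SecondCountableTopology X'] [CompactSpace X']
  [ChartedSpace (EuclideanHalfSpace 4) X'] [IsManifold (𝓡∂ 4) ∞ X']

/-- **Fibred models through a diffeomorphism of the handlebody piece** (the X-slot transport).
Let `M = X ∪_Ψ Base g` (`IsBoundaryGluing bX (bBase g) Ψ`), let `G : X ≅ X'` where `X'` is `Base g`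
with 2-handles attached along a Lefschetz link `h` of word `l` (data `D'`), and let `bX'` be ANY
boundary datum of `X'`.  If `Ψ` is page-preserving at every seam point `y ∈ ∂X` whose image
`G (bX.incl y)` is a base point `D'.jA a` of `X'`, then `M` is fibred-modelled by `(g, l)`: the
witness is `(X', h, D', bX', (∂G⁻¹).trans Ψ)`, the gluing being re-indexed along `G⁻¹`
(Hirsch 1976, §8.2: `M ∪_φ N` only depends on the pieces up to diffeomorphism compatible with the
gluing map; tree: `IsBoundaryGluing.transfer`, `BoundaryData.restrictDiffeomorph`).
[cite: HirschDT1976, Ch. 8 §2] -/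
theorem modelsOnFibred_of_transfer {h : Fin l.length → HandleAttachingMap 3 2 (Base g)}
    (hlink : IsLefschetzLink g l h) (D' : MultiAttachmentData h (𝓡∂ 4) X')
    (bX : BoundaryData (𝓡∂ 4) X (𝓡 3)) (bX' : BoundaryData (𝓡∂ 4) X' (𝓡 3))
    (Ψ : bX.carrier ≃ₘ⟮𝓡 3, 𝓡 3⟯ (bBase g).carrier) (hglue : IsBoundaryGluing bX (bBase g) Ψ (𝓡 4) M)
    (G : X ≃ₘ⟮𝓡∂ 4, 𝓡∂ 4⟯ X')
    (hpage : ∀ (y : bX.carrier) (a : ↥(coresComplement h)), G (bX.incl y) = D'.jA a →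
      ∃ c : ℝ, 0 < c ∧ w g ((bBase g).incl (Ψ y)).1 = (c : ℂ) * w g (a : Base g).1) :
    ModelsOnFibred M g l := by
  -- the re-indexed gluing map `Ψ ∘ ∂G⁻¹ : ∂X' ≅ ∂ Base g`
  let Ψ' : bX'.carrier ≃ₘ⟮𝓡 3, 𝓡 3⟯ (bBase g).carrier :=
    (bX'.restrictDiffeomorph bX G.symm).trans Ψ
  have hglue' : IsBoundaryGluing bX' (bBase g) Ψ' (𝓡 4) M :=
    isBoundaryGluing_restrictDiffeomorph_trans Ψ hglue G
  refine ⟨X', inferInstance, inferInstance, inferInstance, inferInstance, inferInstance,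
    inferInstance, h, D', bX', Ψ', hlink, hglue', fun y' a hy' => ?_⟩
  -- read the page condition through `bX.incl (∂G⁻¹ y') = G⁻¹ (bX'.incl y')`
  have hy : G (bX.incl (bX'.restrictDiffeomorph bX G.symm y')) = D'.jA a := by
    rw [BoundaryData.incl_restrictDiffeomorph, Diffeomorph.apply_symm_apply, hy']
  obtain ⟨c, hc, hw⟩ := hpage _ a hy
  exact ⟨c, hc, by rw [Diffeomorph.coe_trans, comp_apply]; exact hw⟩

omit [IsManifold (𝓡∂ 4) ∞ X] in
/-- **Introduction rule for fibred models with a new link on the same piece** (the case `X' = X`,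
`G = refl` of `modelsOnFibred_of_transfer`, stated directly): if `M = X ∪_Ψ Base g` and `X` carries
multi-attachment data `D'` of a Lefschetz link of word `l` with respect to which `Ψ` is
page-preserving on the unsurgered seam, then `ModelsOnFibred M g l` — the form in which a
re-presentation of the SAME handlebody piece by a new Lefschetz link (handle slides, isotopies of
the attaching link: Kirby 1989, Ch. I §1) is fed back into the fibred model.
[cite: EtnyreFuller2006, Thm. 1 (proof, p. 8)] -/
theorem modelsOnFibred_of_data [T2Space X] [SecondCountableTopology X] [CompactSpace X]
    [IsManifold (𝓡∂ 4) ∞ X] {h : Fin l.length → HandleAttachingMap 3 2 (Base g)}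
    (hlink : IsLefschetzLink g l h) (D' : MultiAttachmentData h (𝓡∂ 4) X)
    (bX : BoundaryData (𝓡∂ 4) X (𝓡 3)) (Ψ : bX.carrier ≃ₘ⟮𝓡 3, 𝓡 3⟯ (bBase g).carrier)
    (hglue : IsBoundaryGluing bX (bBase g) Ψ (𝓡 4) M)
    (hpage : ∀ (y : bX.carrier) (a : ↥(coresComplement h)), bX.incl y = D'.jA a →
      ∃ c : ℝ, 0 < c ∧ w g ((bBase g).incl (Ψ y)).1 = (c : ℂ) * w g (a : Base g).1) :
    ModelsOnFibred M g l :=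
  ⟨X, inferInstance, inferInstance, inferInstance, inferInstance, inferInstance, inferInstance,
    h, D', bX, Ψ, hlink, hglue, hpage⟩

end Transfer

/-- **T3, registered form: the handlebody slot of a fibred model along a diffeomorphism**
`G : X ≅ X'` of the piece, for any boundary datum of `X'` and any multi-attachment data on `X'` of a
Lefschetz link of word `l` with respect to which `Ψ ∘ ∂G⁻¹` is page-preserving (Hirsch 1976, §8.2
via `IsBoundaryGluing.transfer`; see `modelsOnFibred_of_transfer`). [cite: HirschDT1976, Ch. 8 §2] -/
theorem helper_modelsOnFibred_of_transfer :
    ∀ (M : Type) [TopologicalSpace M] [ChartedSpace (EuclideanSpace ℝ (Fin 4)) M] (g : ℕ)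
      (l : List ((Fin g ⊕ Fin g → ℤ) × Bool)) (X X' : Type) [TopologicalSpace X]
      [ChartedSpace (EuclideanHalfSpace 4) X] [IsManifold (𝓡∂ 4) ∞ X] [TopologicalSpace X']
      [T2Space X'] [SecondCountableTopology X'] [CompactSpace X']
      [ChartedSpace (EuclideanHalfSpace 4) X'] [IsManifold (𝓡∂ 4) ∞ X']
      (h : Fin l.length → HandleAttachingMap 3 2 (Base g))
      (D' : HandleAttachingMap.MultiAttachmentData h (𝓡∂ 4) X')
      (bX : BoundaryData (𝓡∂ 4) X (𝓡 3)) (bX' : BoundaryData (𝓡∂ 4) X' (𝓡 3))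
      (Ψ : bX.carrier ≃ₘ⟮𝓡 3, 𝓡 3⟯ (bBase g).carrier) (G : X ≃ₘ⟮𝓡∂ 4, 𝓡∂ 4⟯ X'),
      IsLefschetzLink g l h → IsBoundaryGluing bX (bBase g) Ψ (𝓡 4) M →
      (∀ (y : bX.carrier) (a : ↥(HandleAttachingMap.coresComplement h)), G (bX.incl y) = D'.jA a →
        ∃ c : ℝ, 0 < c ∧ w g ((bBase g).incl (Ψ y)).1 = (c : ℂ) * w g (a : Base g).1) →
      ModelsOnFibred M g l :=
  fun _ _ _ _ _ _ _ _ _ _ _ _ _ _ _ _ _ D' bX bX' Ψ G hlink hglue hpage =>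
    modelsOnFibred_of_transfer hlink D' bX bX' Ψ hglue G hpage

end Summit.SmoothPoincare4.SmoothPoincare4.Theorems.AcyclicBisectionExists.ModpBraidOrbits

end
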